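import Literature.Computability.Cryptography.CsidhGenerators
import Literature.Computability.Complexity.BoolEncodings
import Literature.Computability.Complexity.TM2PassThrough
import HarnessLib

/-!
# The CSIDH torsor as a white-box torsor family on bit strings

Topic `Computability/Cryptography` (definition item `defn-csidhTorsorFamily`, wanted by route
QuantumAdvantage/PadKuperberg, item CsidhInstantiation; follow-up of `CsidhAction.lean` and
`CsidhGenerators.lean`, which define the mathematical action and defer "bit-string encodings of
the family" to this file). The white-box torsor interface of the route quantifies over

* `lab elt : List Bool → List Bool → Bool` (labels of group elements / elements of the set, per
  parameter string), `one : List Bool → List Bool`, `mul act : List Bool → List Bool → List Bool →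
  List Bool`, `gens : List Bool → List (List Bool)`,

subject to thirteen torsor axioms that must hold for **every** parameter string. This file
instantiates these six components with the CSIDH/CRS torsor of Castryck–Lange–Martindale–Panny–
Renes (ASIACRYPT 2018, §3 Thm. 7, §5 Prop. 8): for a prime `p ≡ 3 (mod 8)`, `p ≥ 5`, the class
group `cl(ℤ[√-p])`, labelled by reduced forms of discriminant `-4p` (`IsLabel (-p)`, law `comp`,
unit `principalForm`, Cox Thm. 7.7), acting by `Csidh.act p` on the valid Montgomery coefficients
`A : ZMod p` (`Csidh.IsCoeff p`), with generator list `Csidh.gens p`. Everything here is encoding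
plumbing with bodies; no complexity statement and no named fact is introduced, and the bodies do
not mention the named facts `csidh_classGroupAction` / `jmv_smallPrimesGenerate` (they enter the
route only as hypotheses of theorems about these components).

* `encForm f` — the code of a form `(a, b, c)`: the `boolPair`-nested triple of the tree's integer
  codes `encodingIntBool` (sign bit, binary digits of `|·|`); `decForm`/`formOf` decode it
  (`decForm_encForm`, `formOf_encForm`, `encForm_injective`, `length_encForm`);
* `encCoeff A = encodeNat A.val` — the code of `A : ZMod p`; `coeffOf p z = decodeNat z (mod p)`
  (`coeffOf_encCoeff`, `encCoeff_injective`);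
* `param p = boolPair (encodeNat p) 1^(padConst · |encodeNat p|)` — the parameter string of the
  prime `p` (`padConst = 12`), padded so that every label code fits: `|encForm f| ≤ |param p|` for
  every label `f` of discriminant `-4p` (`length_encForm_le_length_param`, interface clause 11;
  a reduced form has `a, |b|, c < 2p`), while `|param p| = 14 |encodeNat p| + 2 = Θ(log p)`;
  `paramPrime` decodes it (`paramPrime_param`);
* `IsValidParam P₀ prm` — `prm = param p` for a prime `p ≡ 3 (mod 8)` with `5 ≤ p` and `P₀ ≤ p`;
  the threshold `P₀ : ℕ` is the first argument of every component (under GRH the listed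
  generators generate `cl(ℤ[√-p])` only for `p ≥ P₀`, `exists_closure_toClass_gens_eq_top`);
* the mathematical level at a prime `p` on codes: `IsLabelCode p g` (`g = encForm f`, `f` a
  label), `IsCoeffCode p z` (`z = encCoeff A`, `A` valid), `oneCode`, `mulCode`, `actCode`,
  `gensCode` (transport of `principalForm`, `comp`, `act`, `gens` through the codes);
* **the family** `csidhLab csidhElt csidhOne csidhMul csidhAct csidhGens` (threshold `P₀`, then
  the parameter string; bundled as the tuple `csidhTorsorFamily P₀`): on a valid parameter the
  transported CSIDH torsor; on an invalid parameter the trivial one-point torsor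
  (`lab g := g = []`, `elt z := z = []`, `one := []`, `mul := []`, `act g z := z`, `gens := []`),
  and junk `[]` (resp. `z`) on invalid label/element arguments, so that the interface axioms hold
  for every parameter string;
* unfolding lemmas at `prm = param p`: `csidhLab_param_iff`, `csidhElt_param_iff`,
  `csidhOne_param`, `csidhMul_param`, `csidhAct_param`, `csidhGens_param`, the `_of_not` lemmas
  off the valid parameters, and the unconditional interface clauses `csidhLab_csidhOne`
  (clause 2), `length_le_of_csidhLab` (clause 11), `csidhLab_of_mem_csidhGens` (clause 12).

The remaining torsor axioms follow from `cox_formClassGroup_holds` (group axioms), the clauses of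
`csidh_classGroupAction` (clauses (1)–(2) being the tree's theorems `isCoeff_act'`,
`act_principalForm'`, `act_comp'`) and generation (`exists_closure_toClass_gens_eq_top`) through
these lemmas; they are derived in the proofs companion `CsidhTorsorFamilyAxioms.lean`
(`torsorAxioms`, `exists_torsorAxioms`), not here. In print the action of an arbitrary class is
evaluated in randomized subexponential time `L_p(1/2)` under GRH (Childs–Jao–Soukharev 2014,
Thm. 2.1 ff.); no running-time statement is made in this file.

## References

* [CastryckEtAl2018] W. Castryck, T. Lange, C. Martindale, L. Panny, J. Renes, *CSIDH: an
  efficient post-quantum commutative group action*, ASIACRYPT 2018, LNCS 11274, §3 Thm. 7,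
  §5 Prop. 8 (public keys are the coefficients `A ∈ 𝔽_p`), §8.
* [Cox2013] D. A. Cox, *Primes of the form x² + ny²*, 2nd ed., Thm. 2.8 (reduced forms,
  `a ≤ √(|D|/3)`), Thm. 7.7.
* [AroraBarak2009] S. Arora, B. Barak, *Computational Complexity*, §0.1 (pairing `⟨x, y⟩`,
  representing integers and tuples as strings).
-/

noncomputable section

open scoped Classical

namespace Literature.Computability.Cryptography.Csidh

open _root_.Computability
open Literature.Computability.Complexity
open Literature.NumberTheory.QuadraticFields.Quadratic
open Literature.NumberTheory.QuadraticFields.Quadratic.BinQF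

attribute [local instance] isDomain_zsqrtd_neg

/-! ### Binary length of naturals -/

/-- `|encodeNat m| ≤ |encodeNat p| + 1` whenever `m < 2p` (`|encodeNat n| = Nat.size n`, the tree's
`TM2Pass.length_encodeNat_eq_size`). [folklore] -/
theorem length_encodeNat_le_succ_of_lt_two_mul {m p : ℕ} (h : m < 2 * p) :
    (encodeNat m).length ≤ (encodeNat p).length + 1 := by
  rw [TM2Pass.length_encodeNat_eq_size, TM2Pass.length_encodeNat_eq_size, Nat.size_le, pow_succ]
  have := Nat.lt_size_self p
  omega

/-! ### Codes of forms -/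

/-- **The code of a form** `f = (a, b, c)`: the `boolPair`-nested triple `⟨â, ⟨b̂, ĉ⟩⟩` of the
tree's integer codes (`encodingIntBool`: the sign bit paired with the binary digits of the
absolute value), i.e. the value at `(a, b, c)` of the encoding
`encodingIntBool.pairBool (encodingIntBool.pairBool encodingIntBool)` of `ℤ × ℤ × ℤ`
(Arora–Barak §0.1: tuples of integers as strings via the pairing `⟨·, ·⟩`).
[cite: AroraBarak2009, §0.1] -/
def encForm (f : BinQF) : List Bool :=
  (encodingIntBool.pairBool (encodingIntBool.pairBool encodingIntBool)).encode (f.a, f.b, f.c)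

/-- The decoder of `encForm` (`none` on strings that do not decode as integer triples).
[folklore] -/
def decForm (g : List Bool) : Option BinQF :=
  ((encodingIntBool.pairBool (encodingIntBool.pairBool encodingIntBool)).decode g).map
    fun t => ⟨t.1, t.2.1, t.2.2⟩

/-- `decForm ∘ encForm = some`. [folklore] -/
@[simp] theorem decForm_encForm (f : BinQF) : decForm (encForm f) = some f := by
  rw [decForm, encForm, Encoding.decode_encode, Option.map_some]

/-- Forms over the alphabet `{0, 1}` as a Mathlib `Encoding`. [folklore] -/
def formEncoding : Encoding BinQF Bool where
  encode := encForm
  decode := decForm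
  decode_encode := decForm_encForm

/-- `encForm` is injective. [folklore] -/
theorem encForm_injective : Function.Injective encForm :=
  formEncoding.encode_injective

/-- The total decoder: the form coded by `g` (junk `principalForm 0` on non-codes). [folklore] -/
def formOf (g : List Bool) : BinQF := (decForm g).getD (principalForm 0)

/-- `formOf (encForm f) = f`. [folklore] -/
@[simp] theorem formOf_encForm (f : BinQF) : formOf (encForm f) = f := by
  rw [formOf, decForm_encForm, Option.getD_some]

/-- **Length of a form code**: `|encForm (a, b, c)| = 2|â| + 2|b̂| + |ĉ| + 24` in terms of the
binary digit counts of `|a|, |b|, |c|` (each integer code is the doubled sign bit, the separator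
and the binary digits, `|encodeNat |z|| + 4` symbols, cf. the tree's
`length_encodingIntBool_encode`). [folklore] -/
theorem length_encForm (f : BinQF) :
    (encForm f).length = 2 * (encodeNat f.a.natAbs).length + 2 * (encodeNat f.b.natAbs).length +
      (encodeNat f.c.natAbs).length + 24 := by
  have hint : ∀ z : ℤ, (encodingIntBool.encode z).length = (encodeNat z.natAbs).length + 4 := by
    intro z
    change (boolPair (encodingBoolBool.encode (decide (z < 0))) (encodeNat z.natAbs)).length = _
    rw [length_boolPair]
    have : (encodingBoolBool.encode (decide (z < 0))).length = 1 := rfl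
    omega
  change (boolPair (encodingIntBool.encode f.a)
    (boolPair (encodingIntBool.encode f.b) (encodingIntBool.encode f.c))).length = _
  rw [length_boolPair, length_boolPair, hint, hint, hint]
  omega

/-! ### Codes of Montgomery coefficients -/

/-- **The code of a coefficient** `A ∈ 𝔽_p`: the binary digits of its representative in
`{0, …, p - 1}` (CSIDH §5: public keys are the elements `A ∈ 𝔽_p`; Arora–Barak §0.1).
[cite: CastryckEtAl2018, §5 Prop. 8] -/
def encCoeff {p : ℕ} (A : ZMod p) : List Bool := encodeNat A.val

/-- The coefficient coded by `z`, read modulo `p` (total; meaningful on codes). [folklore] -/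
def coeffOf (p : ℕ) (z : List Bool) : ZMod p := ((decodeNat z : ℕ) : ZMod p)

/-- `coeffOf p (encCoeff A) = A`. [folklore] -/
@[simp] theorem coeffOf_encCoeff {p : ℕ} [NeZero p] (A : ZMod p) : coeffOf p (encCoeff A) = A := by
  rw [coeffOf, encCoeff, decode_encodeNat, ZMod.natCast_zmod_val]

/-- `encCoeff` is injective. [folklore] -/
theorem encCoeff_injective (p : ℕ) [NeZero p] : Function.Injective (encCoeff (p := p)) :=
  fun A B h => by rw [← coeffOf_encCoeff A, ← coeffOf_encCoeff B, h]

/-- A coefficient code is no longer than the binary code of `p`. [folklore] -/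
theorem length_encCoeff_le {p : ℕ} [NeZero p] (A : ZMod p) :
    (encCoeff A).length ≤ (encodeNat p).length := by
  rw [encCoeff, TM2Pass.length_encodeNat_eq_size, TM2Pass.length_encodeNat_eq_size]
  exact Nat.size_le_size (ZMod.val_lt A).le

/-! ### Parameter strings -/

/-- The padding constant of the parameter strings (chosen so that label codes fit,
`length_encForm_le_length_param`). [folklore] -/
def padConst : ℕ := 12

/-- **The parameter string of the prime `p`**: `⟨encodeNat p, 1^(padConst · |encodeNat p|)⟩`, the
binary digits of `p` paired with a padding block of proportional length, so that
`|param p| = (padConst + 2) |encodeNat p| + 2 = Θ(log p)`. [folklore] -/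
def param (p : ℕ) : List Bool :=
  boolPair (encodeNat p) (List.replicate (padConst * (encodeNat p).length) true)

/-- `|param p| = 14 |encodeNat p| + 2`. [folklore] -/
theorem length_param (p : ℕ) : (param p).length = (padConst + 2) * (encodeNat p).length + 2 := by
  rw [param, length_boolPair, List.length_replicate]
  ring

/-- The prime named by a parameter string (junk on malformed strings). [folklore] -/
def paramPrime (prm : List Bool) : ℕ := decodeNat (boolUnpair prm).1

/-- `paramPrime (param p) = p`. [folklore] -/
@[simp] theorem paramPrime_param (p : ℕ) : paramPrime (param p) = p := by
  rw [paramPrime, param, boolUnpair_boolPair, decode_encodeNat]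

/-- `param` is injective. [folklore] -/
theorem param_injective : Function.Injective param :=
  fun p q h => by rw [← paramPrime_param p, ← paramPrime_param q, h]

/-- **Valid parameters at threshold `P₀`**: the parameter strings of the primes `p ≡ 3 (mod 8)`
with `5 ≤ p` (the standing hypotheses of CSIDH Thm. 7 / Prop. 8 as used in
`csidh_classGroupAction`) and `P₀ ≤ p`. [cite: CastryckEtAl2018, §5 Prop. 8] -/
def IsValidParam (P₀ : ℕ) (prm : List Bool) : Prop :=
  ∃ p : ℕ, p.Prime ∧ p % 8 = 3 ∧ 5 ≤ p ∧ P₀ ≤ p ∧ prm = param p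

/-- Validity of `param p`. [folklore] -/
theorem isValidParam_param_iff {P₀ p : ℕ} :
    IsValidParam P₀ (param p) ↔ p.Prime ∧ p % 8 = 3 ∧ 5 ≤ p ∧ P₀ ≤ p := by
  constructor
  · rintro ⟨q, hq, h8, h5, hP, he⟩
    obtain rfl : p = q := param_injective he
    exact ⟨hq, h8, h5, hP⟩
  · rintro ⟨hq, h8, h5, hP⟩
    exact ⟨p, hq, h8, h5, hP, rfl⟩

/-- A valid parameter is `param` of the prime it names, which satisfies the side conditions.
[folklore] -/
theorem IsValidParam.spec {P₀ : ℕ} {prm : List Bool} (h : IsValidParam P₀ prm) :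
    (paramPrime prm).Prime ∧ paramPrime prm % 8 = 3 ∧ 5 ≤ paramPrime prm ∧ P₀ ≤ paramPrime prm ∧
      prm = param (paramPrime prm) := by
  obtain ⟨p, hp, h8, h5, hP, rfl⟩ := h
  rw [paramPrime_param]
  exact ⟨hp, h8, h5, hP, rfl⟩

/-- Validity is monotone in the threshold. [folklore] -/
theorem IsValidParam.mono {P₀ P₁ : ℕ} (hP : P₀ ≤ P₁) {prm : List Bool} (h : IsValidParam P₁ prm) :
    IsValidParam P₀ prm := by
  obtain ⟨p, hp, h8, h5, hP', rfl⟩ := h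
  exact ⟨p, hp, h8, h5, hP.trans hP', rfl⟩

/-! ### Label codes fit into the parameter string (interface clause 11) -/

/-- Coefficient bounds for a label of discriminant `-4p`: `a, |b|, c < 2p` (from `|b| ≤ a ≤ c` and
`4ac = b² + 4p ≤ a² + 4p ≤ ac + 4p`, i.e. `3ac ≤ 4p`; Cox (2.8): `a ≤ √(4p/3)`).
[cite: Cox2013, §2.A eq. (2.8)] -/
theorem natAbs_lt_of_isLabel {p : ℕ} {f : BinQF} (hf : IsLabel (-(p : ℤ)) f) :
    f.a.natAbs < 2 * p ∧ f.b.natAbs < 2 * p ∧ f.c.natAbs < 2 * p := by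
  obtain ⟨⟨hdisc, ha, -⟩, hb, hac, -⟩ := hf
  simp only [disc] at hdisc
  have hb2 : f.b ^ 2 ≤ f.a ^ 2 := by nlinarith [abs_nonneg f.b, abs_mul_abs_self f.b, abs_le.1 hb]
  have h3 : 3 * (f.a * f.c) ≤ 4 * p := by nlinarith
  have hc : 0 < f.c := lt_of_lt_of_le ha hac
  have hp : (0 : ℤ) < p := by nlinarith
  have ha' : f.a < 2 * p := by nlinarith
  have hc' : f.c < 2 * p := by nlinarith
  have hb' : |f.b| < 2 * p := lt_of_le_of_lt hb ha'
  refine ⟨?_, ?_, ?_⟩ <;> zify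
  · rw [abs_of_pos ha]; exact ha'
  · exact hb'
  · rw [abs_of_pos hc]; exact hc'

/-- **Label codes fit** (interface clause 11 of the route): for `p ≥ 4` and a label `f` of
discriminant `-4p`, `|encForm f| ≤ |param p|` (`|encForm f| ≤ 5 |encodeNat p| + 29 ≤
14 |encodeNat p| + 2` as `|encodeNat p| ≥ 3`). [folklore] -/
theorem length_encForm_le_length_param {p : ℕ} (hp : 4 ≤ p) {f : BinQF}
    (hf : IsLabel (-(p : ℤ)) f) : (encForm f).length ≤ (param p).length := by
  obtain ⟨ha, hb, hc⟩ := natAbs_lt_of_isLabel hf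
  have la := length_encodeNat_le_succ_of_lt_two_mul ha
  have lb := length_encodeNat_le_succ_of_lt_two_mul hb
  have lc := length_encodeNat_le_succ_of_lt_two_mul hc
  have hL : 3 ≤ (encodeNat p).length := by
    rw [TM2Pass.length_encodeNat_eq_size]
    by_contra h
    have := Nat.size_le.1 (Nat.le_of_lt_succ (not_le.1 h))
    omega
  rw [length_encForm, length_param, padConst]
  omega

/-! ### The torsor at a prime `p`, on codes -/

section Codes

variable (p : ℕ)

/-- **Label codes**: `g` is the code of a label (reduced primitive positive definite form of
discriminant `-4p`, Cox Thm. 2.8 / 7.7: the canonical names of the classes of `cl(ℤ[√-p])`).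
[cite: Cox2013, §7.B Thm. 7.7] -/
def IsLabelCode (g : List Bool) : Prop := ∃ f : BinQF, IsLabel (-(p : ℤ)) f ∧ g = encForm f

/-- **Element codes**: `z` is the code of a valid Montgomery coefficient (`Csidh.IsCoeff p`:
`E_A : y² = x³ + Ax² + x` smooth and supersingular over `𝔽_p`; CSIDH §5). The primality of `p`
(needed to speak of `E_A(𝔽_p)`) is part of the statement. [cite: CastryckEtAl2018, §5 Prop. 8] -/
def IsCoeffCode (z : List Bool) : Prop :=
  ∃ hp : p.Prime, haveI : Fact p.Prime := ⟨hp⟩; ∃ A : ZMod p, IsCoeff p A ∧ z = encCoeff A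

/-- The code of the unit: the principal form `(1, 0, p)`. [folklore] -/
def oneCode : List Bool := encForm (principalForm (-(p : ℤ)))

/-- The law on codes: the code of the composite label (`comp (-p)`, Cox Thm. 7.7(ii)) of the
decoded forms (junk `[]` if `p` is not prime). [folklore] -/
def mulCode (g h : List Bool) : List Bool :=
  if hp : p.Prime then
    haveI : Fact p.Prime := ⟨hp⟩
    encForm (comp (-(p : ℤ)) (formOf g) (formOf h))
  else []

/-- The action on codes: the code of `[𝔞_f] ⋆ E_A` (`Csidh.act p`, CSIDH Thm. 7) for the decoded
label `f` and coefficient `A` (junk `[]` if `p` is not prime).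
[cite: CastryckEtAl2018, §3 Thm. 7] -/
def actCode (g z : List Bool) : List Bool :=
  if hp : p.Prime then
    haveI : Fact p.Prime := ⟨hp⟩
    encCoeff (act p (formOf g) (coeffOf p z))
  else []

/-- The generator codes: the codes of the CSIDH generator list `Csidh.gens p` (junk `[]` if `p` is
not prime). [folklore] -/
def gensCode : List (List Bool) :=
  if hp : p.Prime then
    haveI : Fact p.Prime := ⟨hp⟩
    (gens p).map encForm
  else []

variable {p}

/-- `encForm f` is a label code iff `f` is a label. [folklore] -/
@[simp] theorem isLabelCode_encForm_iff {f : BinQF} :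
    IsLabelCode p (encForm f) ↔ IsLabel (-(p : ℤ)) f := by
  constructor
  · rintro ⟨f', hf', he⟩
    rwa [encForm_injective he]
  · exact fun hf => ⟨f, hf, rfl⟩

/-- A label code is the code of the form it decodes to, which is a label. [folklore] -/
theorem IsLabelCode.eq_encForm {g : List Bool} (hg : IsLabelCode p g) :
    g = encForm (formOf g) ∧ IsLabel (-(p : ℤ)) (formOf g) := by
  obtain ⟨f, hf, rfl⟩ := hg
  rw [formOf_encForm]
  exact ⟨rfl, hf⟩

/-- The principal form's code is a label code (`p ≥ 1`). [folklore] -/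
theorem isLabelCode_oneCode (hp : 1 ≤ p) : IsLabelCode p (oneCode p) :=
  ⟨_, isLabel_principalForm _ (by omega), rfl⟩

section Prime

variable [Fact p.Prime]

/-- Element codes at a prime: `z = encCoeff A` for a valid `A`. [folklore] -/
theorem isCoeffCode_iff {z : List Bool} :
    IsCoeffCode p z ↔ ∃ A : ZMod p, IsCoeff p A ∧ z = encCoeff A :=
  ⟨fun ⟨_, A, hA, hz⟩ => ⟨A, hA, hz⟩, fun ⟨A, hA, hz⟩ => ⟨Fact.out, A, hA, hz⟩⟩

/-- `encCoeff A` is an element code iff `A` is a valid coefficient. [folklore] -/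
@[simp] theorem isCoeffCode_encCoeff_iff {A : ZMod p} :
    IsCoeffCode p (encCoeff A) ↔ IsCoeff p A := by
  haveI : NeZero p := ⟨(Fact.out : p.Prime).ne_zero⟩
  rw [isCoeffCode_iff]
  constructor
  · rintro ⟨B, hB, he⟩
    rwa [encCoeff_injective p he]
  · exact fun hA => ⟨A, hA, rfl⟩

/-- An element code is the code of the coefficient it decodes to, which is valid. [folklore] -/
theorem IsCoeffCode.eq_encCoeff {z : List Bool} (hz : IsCoeffCode p z) :
    z = encCoeff (coeffOf p z) ∧ IsCoeff p (coeffOf p z) := by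
  haveI : NeZero p := ⟨(Fact.out : p.Prime).ne_zero⟩
  obtain ⟨A, hA, rfl⟩ := isCoeffCode_iff.1 hz
  rw [coeffOf_encCoeff]
  exact ⟨rfl, hA⟩

/-- `mulCode` at a prime. [folklore] -/
theorem mulCode_eq (g h : List Bool) :
    mulCode p g h = encForm (comp (-(p : ℤ)) (formOf g) (formOf h)) :=
  dif_pos Fact.out

/-- `mulCode` on codes of forms is the code of the composite. [folklore] -/
theorem mulCode_encForm (f g : BinQF) :
    mulCode p (encForm f) (encForm g) = encForm (comp (-(p : ℤ)) f g) := by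
  rw [mulCode_eq, formOf_encForm, formOf_encForm]

/-- `actCode` at a prime. [folklore] -/
theorem actCode_eq (g z : List Bool) :
    actCode p g z = encCoeff (act p (formOf g) (coeffOf p z)) :=
  dif_pos Fact.out

/-- `actCode` on codes is the code of the action. [folklore] -/
theorem actCode_encForm_encCoeff (f : BinQF) (A : ZMod p) :
    actCode p (encForm f) (encCoeff A) = encCoeff (act p f A) := by
  haveI : NeZero p := ⟨(Fact.out : p.Prime).ne_zero⟩
  rw [actCode_eq, formOf_encForm, coeffOf_encCoeff]

/-- `gensCode` at a prime is the list of codes of `gens p`. [folklore] -/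
theorem gensCode_eq : gensCode p = (gens p).map encForm :=
  dif_pos Fact.out

end Prime

end Codes

/-! ### The family -/

/-- **Labels** of the CSIDH torsor family at threshold `P₀`: on a valid parameter (the string of a
prime `p ≡ 3 (mod 8)`, `5 ≤ p`, `P₀ ≤ p`) the codes of the reduced forms of discriminant `-4p`
(the elements of `cl(ℤ[√-p])`, Cox Thm. 7.7); on an invalid parameter only the empty string (the
trivial group). [cite: CastryckEtAl2018, §3 Thm. 7] -/
def csidhLab (P₀ : ℕ) (prm g : List Bool) : Bool :=
  if IsValidParam P₀ prm then decide (IsLabelCode (paramPrime prm) g) else decide (g = [])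

/-- **Elements** of the CSIDH torsor family: on a valid parameter the codes of the valid
Montgomery coefficients `A ∈ 𝔽_p` (`E_A` smooth supersingular, CSIDH §5: the set
`Ell_p(ℤ[π], π)` by Prop. 8); on an invalid parameter only the empty string (the one-point set).
[cite: CastryckEtAl2018, §5 Prop. 8] -/
def csidhElt (P₀ : ℕ) (prm z : List Bool) : Bool :=
  if IsValidParam P₀ prm then decide (IsCoeffCode (paramPrime prm) z) else decide (z = [])

/-- **Unit** of the CSIDH torsor family: the code of the principal form `(1, 0, p)` on a valid
parameter, `[]` otherwise. [folklore] -/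
def csidhOne (P₀ : ℕ) (prm : List Bool) : List Bool :=
  if IsValidParam P₀ prm then oneCode (paramPrime prm) else []

/-- **Group law** of the CSIDH torsor family: composition of labels (`comp (-p)`, the law of
`cl(ℤ[√-p])` transported to reduced forms, Cox Thm. 7.7(ii)) on label codes of a valid
parameter; junk `[]` otherwise. [cite: Cox2013, §7.B Thm. 7.7(ii)] -/
def csidhMul (P₀ : ℕ) (prm g h : List Bool) : List Bool :=
  if IsValidParam P₀ prm ∧ IsLabelCode (paramPrime prm) g ∧ IsLabelCode (paramPrime prm) h then
    mulCode (paramPrime prm) g h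
  else []

/-- **Action** of the CSIDH torsor family: `([𝔞], E_A) ↦ [𝔞] ⋆ E_A = E_A / E_A[𝔞]` read on codes
(`Csidh.act p`, CSIDH §3 Thm. 7 with §5 Prop. 8) for a label code and an element code of a valid
parameter; the junk value `z` otherwise (in particular the trivial action on an invalid
parameter). [cite: CastryckEtAl2018, §3 Thm. 7] -/
def csidhAct (P₀ : ℕ) (prm g z : List Bool) : List Bool :=
  if IsValidParam P₀ prm ∧ IsLabelCode (paramPrime prm) g ∧ IsCoeffCode (paramPrime prm) z then
    actCode (paramPrime prm) g z
  else z

/-- **Generators** of the CSIDH torsor family: the codes of the generator list `Csidh.gens p`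
(classes of the small split primes `(ℓ, t₀ + √-p)`, `ℓ ≤ (log 4p)³`) on a valid parameter, `[]`
otherwise. [folklore] -/
def csidhGens (P₀ : ℕ) (prm : List Bool) : List (List Bool) :=
  if IsValidParam P₀ prm then gensCode (paramPrime prm) else []

/-- **The CSIDH torsor family** at threshold `P₀`: the six components
`(lab, elt, one, mul, act, gens) = (csidhLab P₀, csidhElt P₀, csidhOne P₀, csidhMul P₀, csidhAct P₀,
csidhGens P₀)` of the white-box torsor interface of the route, bundled under the item's name (the
route quantifies over the components separately; this tuple only names the instantiation).
[cite: CastryckEtAl2018, §3 Thm. 7] -/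
def csidhTorsorFamily (P₀ : ℕ) :
    (List Bool → List Bool → Bool) × (List Bool → List Bool → Bool) × (List Bool → List Bool) ×
      (List Bool → List Bool → List Bool → List Bool) ×
      (List Bool → List Bool → List Bool → List Bool) × (List Bool → List (List Bool)) :=
  (csidhLab P₀, csidhElt P₀, csidhOne P₀, csidhMul P₀, csidhAct P₀, csidhGens P₀)

/-- The components of `csidhTorsorFamily`. [folklore] -/
theorem csidhTorsorFamily_eq (P₀ : ℕ) : csidhTorsorFamily P₀ =
    (csidhLab P₀, csidhElt P₀, csidhOne P₀, csidhMul P₀, csidhAct P₀, csidhGens P₀) :=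
  rfl

/-! ### Unfolding off the valid parameters: the trivial one-point torsor -/

section Invalid

variable {P₀ : ℕ} {prm : List Bool}

/-- Off the valid parameters the only label is `[]`. [folklore] -/
theorem csidhLab_of_not (h : ¬ IsValidParam P₀ prm) (g : List Bool) :
    csidhLab P₀ prm g = decide (g = []) := by
  rw [csidhLab, if_neg h]

/-- Off the valid parameters the only element is `[]`. [folklore] -/
theorem csidhElt_of_not (h : ¬ IsValidParam P₀ prm) (z : List Bool) :
    csidhElt P₀ prm z = decide (z = []) := by
  rw [csidhElt, if_neg h]

/-- Off the valid parameters the unit is `[]`. [folklore] -/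
theorem csidhOne_of_not (h : ¬ IsValidParam P₀ prm) : csidhOne P₀ prm = [] := by
  rw [csidhOne, if_neg h]

/-- Off the valid parameters the law is constantly `[]`. [folklore] -/
theorem csidhMul_of_not (h : ¬ IsValidParam P₀ prm) (g g' : List Bool) :
    csidhMul P₀ prm g g' = [] := by
  rw [csidhMul, if_neg (fun h' => h h'.1)]

/-- Off the valid parameters the action is trivial. [folklore] -/
theorem csidhAct_of_not (h : ¬ IsValidParam P₀ prm) (g z : List Bool) :
    csidhAct P₀ prm g z = z := by
  rw [csidhAct, if_neg (fun h' => h h'.1)]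

/-- Off the valid parameters there are no generators. [folklore] -/
theorem csidhGens_of_not (h : ¬ IsValidParam P₀ prm) : csidhGens P₀ prm = [] := by
  rw [csidhGens, if_neg h]

end Invalid

/-! ### Unfolding on a valid parameter `param p` -/

section Valid

variable {P₀ p : ℕ} [Fact p.Prime]

/-- The validity witness of `param p` from the side conditions. [folklore] -/
theorem isValidParam_param (h8 : p % 8 = 3) (h5 : 5 ≤ p) (hP : P₀ ≤ p) :
    IsValidParam P₀ (param p) :=
  isValidParam_param_iff.2 ⟨Fact.out, h8, h5, hP⟩

omit [Fact p.Prime] in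
/-- **Labels on a valid parameter** are the codes of the labels of discriminant `-4p`.
[folklore] -/
theorem csidhLab_param_iff (hv : IsValidParam P₀ (param p)) (g : List Bool) :
    csidhLab P₀ (param p) g = true ↔ ∃ f : BinQF, IsLabel (-(p : ℤ)) f ∧ g = encForm f := by
  rw [csidhLab, if_pos hv, paramPrime_param, decide_eq_true_iff, IsLabelCode]

omit [Fact p.Prime] in
/-- On a valid parameter, `encForm f` is a label iff `f` is a label. [folklore] -/
theorem csidhLab_param_encForm (hv : IsValidParam P₀ (param p)) (f : BinQF) :
    csidhLab P₀ (param p) (encForm f) = decide (IsLabel (-(p : ℤ)) f) := by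
  rw [csidhLab, if_pos hv, paramPrime_param]
  simp only [isLabelCode_encForm_iff]

/-- **Elements on a valid parameter** are the codes of the valid coefficients `A : ZMod p`.
[folklore] -/
theorem csidhElt_param_iff (hv : IsValidParam P₀ (param p)) (z : List Bool) :
    csidhElt P₀ (param p) z = true ↔ ∃ A : ZMod p, IsCoeff p A ∧ z = encCoeff A := by
  rw [csidhElt, if_pos hv, paramPrime_param, decide_eq_true_iff, isCoeffCode_iff]

/-- On a valid parameter, `encCoeff A` is an element iff `A` is a valid coefficient. [folklore] -/
theorem csidhElt_param_encCoeff (hv : IsValidParam P₀ (param p)) (A : ZMod p) :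
    csidhElt P₀ (param p) (encCoeff A) = decide (IsCoeff p A) := by
  rw [csidhElt, if_pos hv, paramPrime_param]
  simp only [isCoeffCode_encCoeff_iff]

omit [Fact p.Prime] in
/-- **The unit on a valid parameter** is the code of the principal form. [folklore] -/
theorem csidhOne_param (hv : IsValidParam P₀ (param p)) :
    csidhOne P₀ (param p) = encForm (principalForm (-(p : ℤ))) := by
  rw [csidhOne, if_pos hv, paramPrime_param, oneCode]

/-- **The law on a valid parameter**, on codes of labels, is the code of the composite label.
[folklore] -/
theorem csidhMul_param (hv : IsValidParam P₀ (param p)) {f g : BinQF}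
    (hf : IsLabel (-(p : ℤ)) f) (hg : IsLabel (-(p : ℤ)) g) :
    csidhMul P₀ (param p) (encForm f) (encForm g) = encForm (comp (-(p : ℤ)) f g) := by
  rw [csidhMul, paramPrime_param,
    if_pos ⟨hv, isLabelCode_encForm_iff.2 hf, isLabelCode_encForm_iff.2 hg⟩, mulCode_encForm]

omit [Fact p.Prime] in
/-- On a valid parameter the law is junk `[]` unless both arguments are label codes. [folklore] -/
theorem csidhMul_param_of_not (g h : List Bool) (hn : ¬ (IsLabelCode p g ∧ IsLabelCode p h)) :
    csidhMul P₀ (param p) g h = [] := by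
  rw [csidhMul, paramPrime_param, if_neg (fun h' => hn h'.2)]

/-- **The action on a valid parameter**, on the codes of a label `f` and a valid `A`, is the code
of `act p f A`. [folklore] -/
theorem csidhAct_param (hv : IsValidParam P₀ (param p)) {f : BinQF} (hf : IsLabel (-(p : ℤ)) f)
    {A : ZMod p} (hA : IsCoeff p A) :
    csidhAct P₀ (param p) (encForm f) (encCoeff A) = encCoeff (act p f A) := by
  rw [csidhAct, paramPrime_param,
    if_pos ⟨hv, isLabelCode_encForm_iff.2 hf, isCoeffCode_encCoeff_iff.2 hA⟩,
    actCode_encForm_encCoeff]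

omit [Fact p.Prime] in
/-- On a valid parameter the action is the junk value `z` unless `g` is a label code and `z` an
element code. [folklore] -/
theorem csidhAct_param_of_not (g z : List Bool) (hn : ¬ (IsLabelCode p g ∧ IsCoeffCode p z)) :
    csidhAct P₀ (param p) g z = z := by
  rw [csidhAct, paramPrime_param, if_neg (fun h' => hn h'.2)]

/-- **The generators on a valid parameter** are the codes of `gens p`. [folklore] -/
theorem csidhGens_param (hv : IsValidParam P₀ (param p)) :
    csidhGens P₀ (param p) = (gens p).map encForm := by
  rw [csidhGens, if_pos hv, paramPrime_param, gensCode_eq]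

end Valid

/-! ### Unconditional interface clauses -/

section Clauses

variable (P₀ : ℕ) (prm : List Bool)

/-- Case analysis on a parameter string: either it is invalid, or it is `param p` for a prime `p`
with the side conditions (packaged with the `Fact` instance the CSIDH files consume). [folklore] -/
theorem isValidParam_cases :
    ¬ IsValidParam P₀ prm ∨ ∃ (p : ℕ) (_ : Fact p.Prime), p % 8 = 3 ∧ 5 ≤ p ∧ P₀ ≤ p ∧
      prm = param p := by
  by_cases h : IsValidParam P₀ prm
  · obtain ⟨p, hp, h8, h5, hP, rfl⟩ := h
    exact Or.inr ⟨p, ⟨hp⟩, h8, h5, hP, rfl⟩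
  · exact Or.inl h

/-- **Interface clause 2**: the unit is a label, for every parameter string. [folklore] -/
theorem csidhLab_csidhOne : csidhLab P₀ prm (csidhOne P₀ prm) = true := by
  rcases isValidParam_cases P₀ prm with h | ⟨p, _, h8, h5, hP, rfl⟩
  · rw [csidhLab_of_not h, csidhOne_of_not h, decide_eq_true_iff]
  · have hv := isValidParam_param h8 h5 hP
    rw [csidhOne_param hv, csidhLab_param_encForm hv, decide_eq_true_iff]
    exact isLabel_principalForm _ (by have := h5; omega)

/-- **Interface clause 11**: labels are no longer than the parameter string. [folklore] -/
theorem length_le_of_csidhLab {g : List Bool} (hg : csidhLab P₀ prm g = true) :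
    g.length ≤ prm.length := by
  rcases isValidParam_cases P₀ prm with h | ⟨p, _, h8, h5, hP, rfl⟩
  · rw [csidhLab_of_not h, decide_eq_true_iff] at hg
    simp [hg]
  · obtain ⟨f, hf, rfl⟩ := (csidhLab_param_iff (isValidParam_param h8 h5 hP) g).1 hg
    exact length_encForm_le_length_param (by omega) hf

/-- **Interface clause 12**: the listed generators are labels. [folklore] -/
theorem csidhLab_of_mem_csidhGens {g : List Bool} (hg : g ∈ csidhGens P₀ prm) :
    csidhLab P₀ prm g = true := by
  rcases isValidParam_cases P₀ prm with h | ⟨p, _, h8, h5, hP, rfl⟩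
  · rw [csidhGens_of_not h] at hg
    exact absurd hg List.not_mem_nil
  · have hv := isValidParam_param h8 h5 hP
    rw [csidhGens_param hv, List.mem_map] at hg
    obtain ⟨f, hf, rfl⟩ := hg
    rw [csidhLab_param_encForm hv, decide_eq_true_iff]
    exact isLabel_of_mem_gens hf

/-- Labels of an invalid parameter: only `[]`. [folklore] -/
theorem eq_nil_of_csidhLab_of_not {P₀ : ℕ} {prm g : List Bool} (h : ¬ IsValidParam P₀ prm)
    (hg : csidhLab P₀ prm g = true) : g = [] := by
  rwa [csidhLab_of_not h, decide_eq_true_iff] at hg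

/-- Elements of an invalid parameter: only `[]`. [folklore] -/
theorem eq_nil_of_csidhElt_of_not {P₀ : ℕ} {prm z : List Bool} (h : ¬ IsValidParam P₀ prm)
    (hz : csidhElt P₀ prm z = true) : z = [] := by
  rwa [csidhElt_of_not h, decide_eq_true_iff] at hz

end Clauses

end Literature.Computability.Cryptography.Csidh
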